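import Summits.HubbardSuperconductivity.HubbardSuperconductivity.Theorems.AnisotropyChordTransferFibre3TwoHoleBSCertBounds

/-!
# Route `AnisotropyChord` / H0 rotor rung: SOUNDNESS of the bounds certificate and monotonicity of the lifted margin

Seventeenth file of the `TwoHoleBS` (PROP BS) chain (continuation of `…TwoHoleBSCertBounds`):
* `mLow`, ★ `mLow_le_liftMargin` (`s ∈ [s₋, s₊]`, `0 ≤ ‖x_B‖² ≤ X`, `Λs₋ > 1` ⇒ `liftMargin g s ‖x_B‖² Λ ≥ mLow g s₋ s₊ X Λ`);
* `sq_convex`, `sumsq_affine_le` (a sum of squares of affine functions of `u` is bounded on `[u⁻,u⁺]` by its endpoint bound);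
* `cV`, `F0`, `F1`, `f_affine`, `cast_fQ`, `ρ0`, `ρ1`, `res_affine`, `cast_r2Q`;
* ★★ `bounds_of_boundsCert`: for `|d|∞ ≤ 3`, invertible skeleton, `s > 0`, strict CND constant `η`:
  `boundsCert d c μ Fm Fp R N̄ ρ̄ η = true` ⇒ `1/(Fp + R/η) ≤ s ≤ 1/Fm` and `‖x‖² ≤ (1/Fm)²(N̄ + ρ̄)²`.
Prover seat `hubbard-h0-rotor-p2` g3; helper for stmt-HubbardSuperconductivity-19089 (`--supports`, helper class).
WHAT THIS IS NOT: nothing here proves superconductivity in the Hubbard model; the rotor TARGET as originally worded stays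
FALSE (g15 verdict).  Numerical plumbing for ONE input (HOLE₂ near-pair tail constants) of ONE conditional reduction (rung 19089).
Mathlib + tree imports only; no sorry, no axioms.
-/

set_option linter.dupNamespace false
set_option autoImplicit false

namespace Summit.HubbardSuperconductivity.HubbardSuperconductivity.Theorems.AnisotropyChord.Transfer.Fibre3

namespace TwoHoleBS

open Subsample
open scoped BigOperators

/-! ## The lifted margin is monotone in the enclosures -/

/-- the lower margin `mLow = (s₊/(Λs₊ − 1))·g/(8(g + X/(s₋(Λs₋ − 1))))`. [folklore] -/
noncomputable def mLow (g sl su X Λ : ℝ) : ℝ := (su / (Λ * su - 1)) * g / (8 * (g + X / (sl * (Λ * sl - 1))))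

/-- ★ `mLow ≤ liftMargin` when `s ∈ [s₋, s₊]`, `0 ≤ ‖x_B‖² ≤ X`, `Λs₋ > 1`. [folklore] -/
theorem mLow_le_liftMargin (g s xx Λ sl su X : ℝ) (hg : 0 < g) (hsl : 0 < sl) (hs1 : sl ≤ s) (hs2 : s ≤ su)
    (hxx : 0 ≤ xx) (hxX : xx ≤ X) (hΛ : 1 < Λ * sl) : mLow g sl su X Λ ≤ liftMargin g s xx Λ := by
  have hspos : 0 < s := lt_of_lt_of_le hsl hs1
  have hsu : 0 < su := lt_of_lt_of_le hspos hs2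
  have hΛs : 1 < Λ * s := by nlinarith
  have hΛsu : 1 < Λ * su := by nlinarith
  have hΛpos : 0 < Λ := by nlinarith
  -- rewrite `liftMargin` as `(s/(Λs−1))·g/(8(g + xx/(s(Λs−1))))`
  have e : liftMargin g s xx Λ = (s / (Λ * s - 1)) * g / (8 * (g + xx / (s * (Λ * s - 1)))) := by
    unfold liftMargin
    have h1 : Λ * s - 1 ≠ 0 := by linarith
    field_simp
  rw [e]
  unfold mLow
  -- monotone pieces
  have ha : su / (Λ * su - 1) ≤ s / (Λ * s - 1) := by
    rw [div_le_div_iff₀ (by linarith) (by linarith)]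
    nlinarith
  have hb : xx / (s * (Λ * s - 1)) ≤ X / (sl * (Λ * sl - 1)) := by
    have hden : sl * (Λ * sl - 1) ≤ s * (Λ * s - 1) := by nlinarith
    have hden0 : 0 < sl * (Λ * sl - 1) := by nlinarith
    calc xx / (s * (Λ * s - 1)) ≤ xx / (sl * (Λ * sl - 1)) := div_le_div_of_nonneg_left hxx hden0 hden
      _ ≤ X / (sl * (Λ * sl - 1)) := div_le_div_of_nonneg_right hxX hden0.le
  have hXnn : 0 ≤ X / (sl * (Λ * sl - 1)) := div_nonneg (hxx.trans hxX) (by nlinarith)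
  have hxnn : 0 ≤ xx / (s * (Λ * s - 1)) := div_nonneg hxx (by nlinarith)
  have hanum : 0 ≤ su / (Λ * su - 1) := div_nonneg hsu.le (by linarith)
  calc su / (Λ * su - 1) * g / (8 * (g + X / (sl * (Λ * sl - 1))))
      ≤ s / (Λ * s - 1) * g / (8 * (g + X / (sl * (Λ * sl - 1)))) := by
        exact div_le_div_of_nonneg_right (mul_le_mul_of_nonneg_right ha hg.le) (by positivity)
    _ ≤ s / (Λ * s - 1) * g / (8 * (g + xx / (s * (Λ * s - 1)))) := by
        refine div_le_div_of_nonneg_left (by positivity) (by positivity) ?_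
        nlinarith

/-! ## Soundness of the bounds certificate -/

/-- squares are convex: `(λp + (1−λ)q)² ≤ λp² + (1−λ)q²`. [folklore] -/
theorem sq_convex (p q lam : ℝ) (h0 : 0 ≤ lam) (h1 : lam ≤ 1) :
    (lam * p + (1 - lam) * q) ^ 2 ≤ lam * p ^ 2 + (1 - lam) * q ^ 2 := by
  nlinarith [sq_nonneg (p - q), mul_nonneg h0 (sub_nonneg.mpr h1)]

/-- a sum of squares of affine functions is bounded on `[a,b]` by its endpoint bound. [folklore] -/
theorem sumsq_affine_le (s : Finset ℕ) (α β : ℕ → ℝ) (a b u R : ℝ) (hau : a ≤ u) (hub : u ≤ b)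
    (ha : ∑ k ∈ s, (α k + a * β k) ^ 2 ≤ R) (hb : ∑ k ∈ s, (α k + b * β k) ^ 2 ≤ R) :
    ∑ k ∈ s, (α k + u * β k) ^ 2 ≤ R := by
  rcases eq_or_lt_of_le (hau.trans hub) with hab | hab
  · have : u = a := le_antisymm (hab ▸ hub) hau
    rw [this]; exact ha
  · set lam := (b - u) / (b - a) with hlam
    have hba : 0 < b - a := by linarith
    have h0 : 0 ≤ lam := div_nonneg (by linarith) hba.le
    have h1 : lam ≤ 1 := by rw [hlam, div_le_one hba]; linarith
    have hu : u = lam * a + (1 - lam) * b := by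
      rw [hlam]; field_simp; ring
    have key : ∀ k, (α k + u * β k) ^ 2 ≤ lam * (α k + a * β k) ^ 2 + (1 - lam) * (α k + b * β k) ^ 2 := by
      intro k
      have e : α k + u * β k = lam * (α k + a * β k) + (1 - lam) * (α k + b * β k) := by rw [hu]; ring
      rw [e]; exact sq_convex _ _ lam h0 h1
    calc ∑ k ∈ s, (α k + u * β k) ^ 2
        ≤ ∑ k ∈ s, (lam * (α k + a * β k) ^ 2 + (1 - lam) * (α k + b * β k) ^ 2) := Finset.sum_le_sum fun k _ => key k
      _ = lam * ∑ k ∈ s, (α k + a * β k) ^ 2 + (1 - lam) * ∑ k ∈ s, (α k + b * β k) ^ 2 := by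
          rw [Finset.sum_add_distrib, Finset.mul_sum, Finset.mul_sum]
      _ ≤ lam * R + (1 - lam) * R := add_le_add (mul_le_mul_of_nonneg_left ha h0) (mul_le_mul_of_nonneg_left hb (by linarith))
      _ = R := by ring

/-- the real test vector read off the list. [folklore] -/
noncomputable def cV (c : List ℚ) : Fin 5 ⊕ Fin 5 → ℝ := fun p => (getV c (e10 p) : ℝ)

/-- constant part of `f(u)`. [folklore] -/
noncomputable def F0 (d : ℤ × ℤ) (c : List ℚ) : ℝ :=
  ∑ k ∈ Finset.range 10, ∑ l ∈ Finset.range 10,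
    (getV c k : ℝ) * (2 * (((aZ2Qz (iptZN d k - iptZN d l).1 (iptZN d k - iptZN d l).2).1 : ℚ) : ℝ)) * (getV c l : ℝ)

/-- `u`-coefficient of `f(u)`. [folklore] -/
noncomputable def F1 (d : ℤ × ℤ) (c : List ℚ) : ℝ :=
  ∑ k ∈ Finset.range 10, ∑ l ∈ Finset.range 10,
    (getV c k : ℝ) * (2 * (((aZ2Qz (iptZN d k - iptZN d l).1 (iptZN d k - iptZN d l).2).2 : ℚ) : ℝ)) * (getV c l : ℝ)

/-- the real `f` at parameter `u` is `F0 + u·F1`. [folklore] -/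
theorem f_affine (d : ℤ × ℤ) (c : List ℚ) (u : ℝ) :
    ∑ k ∈ Finset.range 10, ∑ l ∈ Finset.range 10, (getV c k : ℝ) * AaffR d u k l * (getV c l : ℝ)
      = F0 d c + u * F1 d c := by
  simp only [F0, F1, AaffR, Finset.mul_sum, ← Finset.sum_add_distrib]
  exact Finset.sum_congr rfl fun k _ => Finset.sum_congr rfl fun l _ => by ring

/-- cast of `fQ`. [folklore] -/
theorem cast_fQ (d : ℤ × ℤ) (c : List ℚ) (u : ℚ) : ((fQ d c u : ℚ) : ℝ) = F0 d c + (u : ℝ) * F1 d c := by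
  rw [← f_affine]
  simp only [fQ, sumR_eq_finset]
  push_cast
  simp only [cast_AgetQ]

/-- constant part of the residual entries. [folklore] -/
noncomputable def ρ0 (d : ℤ × ℤ) (c : List ℚ) (μ : ℚ) (k : ℕ) : ℝ :=
  (∑ l ∈ Finset.range 10, (2 * (((aZ2Qz (iptZN d k - iptZN d l).1 (iptZN d k - iptZN d l).2).1 : ℚ) : ℝ)) * (getV c l : ℝ))
    - (μ : ℝ)

/-- `u`-coefficient of the residual entries. [folklore] -/
noncomputable def ρ1 (d : ℤ × ℤ) (c : List ℚ) (k : ℕ) : ℝ :=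
  ∑ l ∈ Finset.range 10, (2 * (((aZ2Qz (iptZN d k - iptZN d l).1 (iptZN d k - iptZN d l).2).2 : ℚ) : ℝ)) * (getV c l : ℝ)

/-- residual entries are affine in `u`. [folklore] -/
theorem res_affine (d : ℤ × ℤ) (c : List ℚ) (μ : ℚ) (u : ℝ) (k : ℕ) :
    (∑ l ∈ Finset.range 10, AaffR d u k l * (getV c l : ℝ)) - (μ : ℝ) = ρ0 d c μ k + u * ρ1 d c k := by
  simp only [ρ0, ρ1, AaffR, Finset.mul_sum]
  rw [sub_add_eq_add_sub]
  congr 1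
  rw [← Finset.sum_add_distrib]
  exact Finset.sum_congr rfl fun l _ => by ring

/-- cast of `r2Q`. [folklore] -/
theorem cast_r2Q (d : ℤ × ℤ) (c : List ℚ) (μ u : ℚ) :
    ((r2Q d c μ u : ℚ) : ℝ) = ∑ k ∈ Finset.range 10, (ρ0 d c μ k + (u : ℝ) * ρ1 d c k) ^ 2 := by
  simp only [r2Q, sumR_eq_finset, ← res_affine]
  push_cast
  simp only [cast_AgetQ]

/-- ★★ **SOUNDNESS OF THE BOUNDS CERTIFICATE:** for `|d|∞ ≤ 3`, an invertible skeleton with `s > 0`, strict CND constant `η`,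
`boundsCert d c μ Fm Fp R N̄ ρ̄ η = true` gives `1/(Fp + R/η) ≤ s ≤ 1/Fm` and `‖x‖² ≤ (1/Fm)²(N̄ + ρ̄)²`. [folklore] -/
theorem bounds_of_boundsCert (d : ℤ × ℤ) (hwin : d.1.natAbs ≤ 3 ∧ d.2.natAbs ≤ 3)
    (hA : IsUnit (skelA d).det) (hspos : 0 < TwoChannel.svec2 (skelA d)) (η : ℚ)
    (hcnd : ∀ c : Fin 5 ⊕ Fin 5 → ℝ, ∑ r, c r = 0 →
      dotProduct c ((skelA d).mulVec c) ≤ -(η : ℝ) * dotProduct c c)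
    (c : List ℚ) (μ Fm Fp R Nb ρb : ℚ) (h : boundsCert d c μ Fm Fp R Nb ρb η = true) :
    1 / ((Fp : ℝ) + (R : ℝ) / (η : ℝ)) ≤ TwoChannel.svec2 (skelA d) ∧ TwoChannel.svec2 (skelA d) ≤ 1 / (Fm : ℝ) ∧
      dotProduct (TwoChannel.xvec2 (skelA d)) (TwoChannel.xvec2 (skelA d)) ≤ (1 / (Fm : ℝ)) ^ 2 * ((Nb : ℝ) + (ρb : ℝ)) ^ 2 := by
  simp only [boundsCert, Bool.and_eq_true, decide_eq_true_eq] at h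
  obtain ⟨⟨⟨⟨⟨⟨⟨⟨⟨⟨⟨⟨hsum, hFm_lo⟩, hFp_lo⟩, hFm_hi⟩, hFp_hi⟩, hR_lo⟩, hR_hi⟩, hNb⟩, hN2⟩, hρb⟩, hRρ⟩, hFm⟩, hη⟩ := h
  set A := skelA d with hAdef
  set s := TwoChannel.svec2 A with hsdef
  have hsymm : A.IsSymm := skelA_isSymm d
  have hηr : (0 : ℝ) < η := by exact_mod_cast hη
  have hs0 : s ≠ 0 := hspos.ne'
  have hcnd0 : ∀ c : Fin 5 ⊕ Fin 5 → ℝ, ∑ r, c r = 0 → dotProduct c (A.mulVec c) ≤ 0 := by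
    intro c' hc'
    have h1 := hcnd c' hc'
    have h2 : 0 ≤ dotProduct c' c' := Finset.sum_nonneg fun i _ => mul_self_nonneg _
    nlinarith
  -- the real test vector and its sum
  set cr := cV c with hcr
  have hcsum : ∑ p, cr p = 1 := by
    simp only [hcr, cV]
    rw [sum_e10 (fun k => (getV c k : ℝ))]
    rw [sumR_eq_finset] at hsum
    exact_mod_cast hsum
  -- `f(1/π)` between the endpoint bounds
  have hf : dotProduct cr (A.mulVec cr) = F0 d c + (1 / Real.pi) * F1 d c := by
    rw [← dsum_eq_dot, ← f_affine, ← dsum_e10]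
    simp only [hcr, cV, hAdef, skelA_eq_AaffR d hwin]
  have hflo : (Fm : ℝ) ≤ dotProduct cr (A.mulVec cr) := by
    rw [hf]
    have a : (0 : ℝ) ≤ (F0 d c - Fm) + (uLo : ℝ) * F1 d c := by
      have := hFm_lo; rw [← Rat.cast_le (K := ℝ), cast_fQ] at this; linarith
    have b : (0 : ℝ) ≤ (F0 d c - Fm) + (uHi : ℝ) * F1 d c := by
      have := hFm_hi; rw [← Rat.cast_le (K := ℝ), cast_fQ] at this; linarith
    have := affine_nonneg_of_endpoints _ _ _ _ _ uLo_le_inv_pi inv_pi_le_uHi a b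
    linarith
  have hfhi : dotProduct cr (A.mulVec cr) ≤ (Fp : ℝ) := by
    rw [hf]
    have a : (0 : ℝ) ≤ (Fp - F0 d c) + (uLo : ℝ) * (-F1 d c) := by
      have := hFp_lo; rw [← Rat.cast_le (K := ℝ), cast_fQ] at this; linarith
    have b : (0 : ℝ) ≤ (Fp - F0 d c) + (uHi : ℝ) * (-F1 d c) := by
      have := hFp_hi; rw [← Rat.cast_le (K := ℝ), cast_fQ] at this; linarith
    have := affine_nonneg_of_endpoints _ _ _ _ _ uLo_le_inv_pi inv_pi_le_uHi a b
    linarith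
  -- the residual at `1/π`
  have hres : dotProduct (A.mulVec cr - (μ : ℝ) • fun _ => 1) (A.mulVec cr - (μ : ℝ) • fun _ => 1)
      = ∑ k ∈ Finset.range 10, (ρ0 d c μ k + (1 / Real.pi) * ρ1 d c k) ^ 2 := by
    simp only [dotProduct, ← pow_two]
    rw [← sum_e10 (fun k => (ρ0 d c μ k + (1 / Real.pi) * ρ1 d c k) ^ 2)]
    refine Finset.sum_congr rfl fun p _ => ?_
    rw [← res_affine]
    congr 1
    simp only [Pi.sub_apply, Pi.smul_apply, smul_eq_mul, mul_one, Matrix.mulVec, dotProduct]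
    congr 1
    rw [← sum_e10 (fun l => AaffR d (1 / Real.pi) (e10 p) l * (getV c l : ℝ))]
    simp only [hcr, cV, hAdef, skelA_eq_AaffR d hwin]
  have hR : dotProduct (A.mulVec cr - (μ : ℝ) • fun _ => 1) (A.mulVec cr - (μ : ℝ) • fun _ => 1) ≤ (R : ℝ) := by
    rw [hres]
    have a : ∑ k ∈ Finset.range 10, (ρ0 d c μ k + (uLo : ℝ) * ρ1 d c k) ^ 2 ≤ (R : ℝ) := by
      have := hR_lo; rw [← Rat.cast_le (K := ℝ), cast_r2Q] at this; exact this
    have b : ∑ k ∈ Finset.range 10, (ρ0 d c μ k + (uHi : ℝ) * ρ1 d c k) ^ 2 ≤ (R : ℝ) := by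
      have := hR_hi; rw [← Rat.cast_le (K := ℝ), cast_r2Q] at this; exact this
    exact sumsq_affine_le _ _ _ _ _ _ _ uLo_le_inv_pi inv_pi_le_uHi a b
  -- (i) `s ≤ 1/Fm`
  have hFmr : (0 : ℝ) < Fm := by exact_mod_cast hFm
  have hup : s ≤ 1 / (Fm : ℝ) := by
    have h1 := quad_le_inv_svec2 A hsymm hA hs0 hcnd0 cr hcsum
    have h2 : (Fm : ℝ) ≤ 1 / s := hflo.trans h1
    rw [le_one_div hspos hFmr]; exact h2
  -- (ii) `1/(Fp + R/η) ≤ s`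
  have hlow : 1 / ((Fp : ℝ) + (R : ℝ) / (η : ℝ)) ≤ s := by
    have h1 := inv_svec2_le A hsymm hA hs0 η hηr hcnd cr hcsum μ
    have h2 : 1 / s ≤ (Fp : ℝ) + (R : ℝ) / η := by
      have := div_le_div_of_nonneg_right hR hηr.le
      linarith
    have hpos : 0 < (Fp : ℝ) + (R : ℝ) / η := lt_of_lt_of_le (one_div_pos.mpr hspos) h2
    rw [one_div_le hpos hspos]; exact h2
  -- (iii) `‖x‖²`
  have hz := xs_sub_sq_le A hsymm hA hs0 η hηr hcnd cr hcsum μ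
  have hzb : dotProduct ((1 / s) • TwoChannel.xvec2 A - cr) ((1 / s) • TwoChannel.xvec2 A - cr) ≤ (ρb : ℝ) ^ 2 := by
    have h1 : (η : ℝ) ^ 2 * dotProduct ((1 / s) • TwoChannel.xvec2 A - cr) ((1 / s) • TwoChannel.xvec2 A - cr)
        ≤ (η : ℝ) ^ 2 * (ρb : ℝ) ^ 2 := by
      refine hz.trans (hR.trans ?_)
      exact_mod_cast hRρ
    exact le_of_mul_le_mul_left h1 (by positivity)
  have hcN : dotProduct cr cr ≤ (Nb : ℝ) ^ 2 := by
    have e : dotProduct cr cr = ((n2Q c : ℚ) : ℝ) := by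
      simp only [n2Q, sumR_eq_finset]
      push_cast
      rw [← sum_e10 (fun k => (getV c k : ℝ) ^ 2)]
      simp only [dotProduct, hcr, cV, pow_two]
    rw [e]; exact_mod_cast hN2
  have hx := xvec2_sq_le A cr Nb ρb (by exact_mod_cast hNb) (by exact_mod_cast hρb) hs0 hcN hzb
  refine ⟨hlow, hup, hx.trans ?_⟩
  have h1 : s ^ 2 ≤ (1 / (Fm : ℝ)) ^ 2 := pow_le_pow_left₀ hspos.le hup 2
  exact mul_le_mul_of_nonneg_right h1 (sq_nonneg _)

end TwoHoleBS

end Summit.HubbardSuperconductivity.HubbardSuperconductivity.Theorems.AnisotropyChord.Transfer.Fibre3
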